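import Mathlib
import HarnessLib
import HarnessLib.Audit
import Summits.Parity.Statement
import Literature.NumberTheory.Sieve.SingularSeries
import Literature.NumberTheory.Sieve.LevelOfDistribution

/-!
Route: RoughSemiprimeRigidity

DORMANT since 2026-09-03T09:08:04Z (reconciler: no traction for 5 d (last activity statement-checked at 2026-08-29T08:32:56Z); parked, not closed — `ledger route dormant route-Parity-RoughSemiprimeRigidity --off` to reactivate) — unstaffed, not closed; items shared with open routes are served there. `ledger route dormant <id> --off` reactivates.

# Route RoughSemiprimeRigidity — GEH rigidity: rough-semiprime twins are an exact copy of prime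
twins — ONE almost-prime cell gives (log-weighted) Hardy–Littlewood pairs at every fixed shift; the
pairs-to-GHL passage is the listed crux WeightedPairsToGHL

Write W(m) := 2 log q log p if m = qp with primes m^{1/4} < q < p and W(m) := 0 otherwise (the
log-weighted indicator of ROUGH SEMIPRIMES, η = ¼), U_h(N) := Σ_{n≤N} Λ(n) log n · Λ(n+h) log(n+h)
(log-weighted prime pairs at shift h) and 𝔖(h) := singularSeries {0,h}. It suffices to show X = X₀ ∧
X₁ ∧ X₂ ∧ X₃ ∧ X₄ — five listed CRUXES that are, verbatim, the hypotheses of the deciding theorem: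
X₀ = EH (the Elliott–Halberstam conjecture for every θ < 1, max over y ≤ x and over reduced
residues, spelled out verbatim over Mathlib; `Iff.rfl` with
Literature.NumberTheory.Sieve.LevelOfDistribution.ElliottHalberstam); X₁ = RoughSemiprimeBombieri
(the GEH-type input in exactly the strength consumed: for every even h the shifted sequence n ↦
W(n+h) carries Bombieri data (X, g) — X its counting function, g a multiplicative density —
satisfying Bombieri's (A₁)–(A₅) with singular-series constant 𝔖(h), inlined verbatim over Mathlib;
it follows from the sixth crux GEH = ∀ θ < 1,
Literature.NumberTheory.Sieve.GeneralizedElliottHalberstam θ (Polymath 8b Claim 2.6, BY NAME — the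
declared condition of this route) through the provable support GEHGivesRoughBombieri, and EH follows
from GEH by the tree's GEHtoEH.primesHaveLevel_of_forall_geh); X₂ = TwoSidedRigidity (the MECHANISM,
two-sided Bombieri rigidity: EH → for every even h and all Bombieri data for W(·+h) with constant
𝔖(h), Σ_{n≤N} W(n)W(n+h) − ¼·U_h(N) = o(N log²N) — the rough-semiprime twin cell is an EXACT COPY of
the log-weighted prime twin cell, coefficient (1−2η)² = ¼); X₃ = RoughSemiprimeTwins (the ONE
interior point: Σ_{n≤N} W(n)W(n+h) = ¼·𝔖(h)·N log²N + o(N log²N) for every even h — 'twin rough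
semiprimes (qp, q′p′), i.e. prime-entry 2×2 matrices of determinant h with all four primes >
N^{1/4}, have the Hardy–Littlewood count'); X₄ = WeightedPairsToGHL (log-weighted Hardy–Littlewood
pairs at every fixed even shift, U_h(N) = 𝔖(h)·N log²N + o(N log²N), ⟹ GeneralizedHardyLittlewood —
the GHL-hard RESIDUAL: prime k-tuples, general slopes, shift-uniformity, d ≥ 2; equivalent to plain
fixed-shift Hardy–Littlewood pairs by Abel summation, odd shifts being trivial; listed as a crux so
that the route encompasses the whole sub-problem, D-0027 §2.2, and staffed last). DECIDING THE
SUB-PROBLEM (D-0027 §2.1; crux-only since the 2026-08-16 g3 repair): `closes : TwoSidedRigidity → EH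
→ RoughSemiprimeBombieri → RoughSemiprimeTwins → WeightedPairsToGHL → GeneralizedHardyLittlewood` is
a proved ten-line theorem — for even h take (X, g) from RoughSemiprimeBombieri, subtract the
little-o statements of TwoSidedRigidity and RoughSemiprimeTwins and multiply by 4 to get U_h(N) −
𝔖(h)N log²N = o(N log²N), then apply WeightedPairsToGHL — so X literally decides the sub-problem and
no support, assembly or derivation is a hypothesis. The three supports are provable lemmas for
provers, outside `closes`: GEHGivesRoughBombieri (GEH ⟹ X₁), BombieriRoughP2Law and
ShiftedPrimesBombieri (the two one-sided Bombieri laws from which X₂ is proved). Realises card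
geh-rigidity-twin-table, (R1) 'one free parameter for the whole bounded almost-prime twin table', in
its sharpest typed instance. (History: conforming re-filing of route TwinTableRigidity, retired
not-a-thesis 2026-08-15; cone repair 2026-08-15 inlined EH and Bombieri's (A₁)–(A₅) verbatim over
Mathlib + Literature.NumberTheory.Sieve.singularSeries, certificates Equiv.lean attached as
evidence; badge / route-choice / g3 repairs 2026-08-16 made every conjecture-grade input a listed
crux and the deciding theorem crux-only.)
Lean: `TwoSidedRigidity ∧ EH ∧ RoughSemiprimeBombieri ∧ RoughSemiprimeTwins ∧ WeightedPairsToGHL`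

## Assembly
The Assembly item is literally the type of the deciding theorem: `TwoSidedRigidity → EH →
RoughSemiprimeBombieri → RoughSemiprimeTwins → WeightedPairsToGHL → GeneralizedHardyLittlewood`
(restated in the g3 repair; it proves nothing by itself — the proved `closes` above is the deciding
theorem, hypotheses = exactly the five consumed cruxes, conclusion = the sub-problem statement
GeneralizedHardyLittlewood by name). The sixth crux GEH is the named condition of the route and
enters through X₁: `GEH → GEHGivesRoughBombieri → RoughSemiprimeBombieri` is a certified two-line
composition (planner Sketch.lean, rc 0), so once the support GEHGivesRoughBombieri is proved a
tenure edit may replace the hypothesis RoughSemiprimeBombieri of `closes` by GEH.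

CONDITIONAL on Literature.NumberTheory.Sieve.GeneralizedElliottHalberstam — this route is an explicit reduction to that named conjecture (D-0019: crux floor waived).

Rationale: WHY THIS LINE. Mechanism: Bombieri's asymptotic sieve (BombieriAsymptoticSieve1976,
BombieriRIMS1977; kernel-checked in the tree as
Literature.NumberTheory.Sieve.Bombieri1976_asymptotic_sieve_holds with (A₁)–(A₅) and general size,
and bombieri_asymptotic_sieve_holds) says that level-x^{1−ε} Type-I data determine every
almost-prime statistic of a sequence up to ONE scalar, its prime mass α ∈ [0,2] — in general-weights
form T₁^±(w) = W⁺ ± |W⁻| (Bombieri's survey doi:10.1016/b978-0-12-067570-8 pp. 39–40, read; the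
P_r-distribution theorem read from BombieriRIMS1977 p. 5 by grounders and vendored as
Bombieri1976_P2Distribution) with the α-law 'odd-Ω weight = α × expected'
(Friedlander2006ProducingPrimes p. 21, read). The route applies this on BOTH coordinates of (n,
n+h): EH makes m ↦ log²(m−h)·1_P(m−h) a Bombieri sequence, a GEH-type input (crux
RoughSemiprimeBombieri, implied by GEH) makes n ↦ W(n+h) one, and the two affine laws compose to a
rank-one law E_h[W ⊗ W] = W⁺W⁺ + (α_h − 1)·W⁻W⁻ with W⁺ = W⁻ = ½, in which every free parameter
cancels except the twin parameter α_h — so under EH+GEH the parity input can be paid at a cell with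
bilinear structure on both sides (the determinant equation qp − q′p′ = −h in four large primes; cf.
the affine linear sieve for almost-prime points on SL₂-type orbits, BourgainGamburdSarnak2009, and
Evans's theorem that E₂ × E₂ correlations have the HL asymptotic with the same 𝔖(h) on average over
h, arXiv:2102.12297 Thm 1.1/1.3). Imported: sieve theory's parity calculus used as a TRANSFER
PRINCIPLE between binary problems rather than as a lower-bound tool; no spectral/probabilistic
reformulation is needed. What prior routes do not do: MobiusShiftedPrimes and AsymptoticSieve each
isolate ONE parity input under EH / FI axioms on the prime side; none uses GEH two-sidedly or
relocates the parity input to an almost-prime cell. Why ROUGH weights: Λ₂(n+h) and (Λ⋆Λ)(n+h) are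
NOT Bombieri sequences for any multiplicative model (mass on multiples of small primes gives
Σ_{d<x^{1−ε}}|R_d| ≍ A(x), no logarithmic saving; cf. the refuted ConvMomentLevelOne in the
negatives index), whereas for W, supported on m with both prime factors > m^{1/4}, the defect of the
1/φ(d)-model is ≪ x^{3/4+o(1)}. Logical shape (g3 repair 2026-08-16): the deciding theorem is
crux-only — closes : TwoSidedRigidity → EH → RoughSemiprimeBombieri → RoughSemiprimeTwins →
WeightedPairsToGHL → GeneralizedHardyLittlewood — its conjecture-grade inputs EH and
RoughSemiprimeBombieri (≤ GEH, the sixth crux, by the support GEHGivesRoughBombieri; EH ≤ GEH by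
GEHtoEH.primesHaveLevel_of_forall_geh), the mechanism TwoSidedRigidity, the research crux
RoughSemiprimeTwins and the GHL-hard residual WeightedPairsToGHL are all listed cruxes; the supports
are provable lemmas outside `closes`.

RANKED CRUXES. #2 RoughSemiprimeTwins (crux) — for every even h ≥ 2: Σ_{n≤N} W(n)W(n+h) =
¼·𝔖({0,h})·N log²N + o(N log²N), where W(m) = 2 log q log p for m = qp with primes m^{1/4} < q < p
and W = 0 otherwise (card geh-rigidity-twin-table, 'one interior point' = the (2,2) cell in its
rough form). By TwoSidedRigidity it is EQUIVALENT to HL(h) under EH + RoughSemiprimeBombieri;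
unconditionally its averaged-over-h form is Evans's theorem. [difficulty: open-problem] (why it
might fail: fixed-h binary problem, HL-equivalent under EH+GEH by this very route (W⁻W⁻ = ¼ ≠ 0,
parity-sensitive); only averaged-over-h versions are theorems (Evans 2022, H ≥ log^19 X); dispersion
in q reduces it to P₂-pair problems of the same binary type.) [arXiv:2102.12297, Polymath8b2014,
BourgainGamburdSarnak2009, HardyLittlewood1923, arXiv:2603.13416]
#3 TwoSidedRigidity (crux, the mechanism) — EH → for every even h and all Bombieri data (X, g) on n
↦ W(n+h) (Bombieri's (A₁)–(A₅), size = counting function, inlined verbatim) with constant 𝔖({0,h}):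
Σ_{n≤N} W(n)W(n+h) − ¼·U_h(N) = o(N log²N), U_h(N) = Σ_{n≤N} Λ(n) log n · Λ(n+h) log(n+h). Proof
plan (tree + supports only): BombieriRoughP2Law at (W(·+h), X, g) gives Σ W(n)W(n+h) = 𝔖 X(N) log N
− ½Σ_p log²p·W(p+h) + o(N log²N) with X(N) = ½N log N + O(N) (Mertens/PNT); ShiftedPrimesBombieri +
BombieriRoughP2Law at c_m = log²(m−h)1_P(m−h) give Σ_p log²p·W(p+h) = 𝔖 N log²N − ½U_h(N) + o(N
log²N); substitute: ½𝔖NL² − ½(𝔖NL² − ½U) = ¼U. [deps: BombieriRoughP2Law, ShiftedPrimesBombieri]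
[difficulty: L] (why it might fail: rests on Bombieri's general-weights law for the sharp-cutoff
weight W ([B2] 1976 / RIMS 1977 p. 5, r = 2) with error o(A log x) at size ≍ x log x; a secondary
term of the cutoff q > m^{1/4} or of (A₄) could shift the coefficient ¼ (numerics to N = 10⁹:
ΣWW/(¼U) = 0.959 rising as 1 − c/log N, HL-model ratio 0.998 — no signal against ¼ so far).)
[BombieriAsymptoticSieve1976, BombieriRIMS1977, doi:10.1016/b978-0-12-067570-8,
FriedlanderIwaniecPisa1978, Friedlander2006ProducingPrimes, Polymath8b2014]
#4 RoughSemiprimeBombieri (crux; ledger rank 9, conjecture-grade, consumed by `closes`) — for every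
even h there are Bombieri data (X, g) on n ↦ W(n+h) satisfying Bombieri's (A₁)–(A₅) (size = counting
function, level x^{1−ε} for every ε with sup over y ≤ x, crude pointwise remainders, growth,
analytic continuation of the density series) with the ordered Euler product for the constant
𝔖({0,h}) (inlined verbatim over Mathlib; `Iff.rfl` with IsBombieriSequence ∧ HasDensityConstant,
certificate Equiv.lean). The exact GEH-instance the line consumes, no stronger than GEH (support
GEHGivesRoughBombieri); (A₁),(A₃),(A₄),(A₅) are unconditional bookkeeping for g(d) =
1_{(d,h)=1}/φ(d), only (A₂) is GEH content. Grounders/refuters stamp; no prover effort. [difficulty: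
open-problem] (why it might fail: GEH-strength claim for one explicit sequence: level x^{1−ε} for
every ε (sup over y ≤ x) for shifted rough semiprimes is open beyond level ½ (known: ½; 4/7 only
with well-factorable weights); the crude (A₃) remainder and the (A₅) continuation for g =
1_{(d,h)=1}/φ(d) must also hold as typed.) [Polymath8b2014, arXiv:1407.4897, BombieriRIMS1977,
BombieriFriedlanderIwaniecActa1986]
#8 WeightedPairsToGHL (crux, NEW 2026-08-16 g3; the GHL-hard residual, consumed by `closes`) —
log-weighted Hardy–Littlewood pairs at every fixed even shift, ∀ even h ≥ 2: U_h(N) = 𝔖({0,h})·N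
log²N + o(N log²N) (left side verbatim the twin sum of TwoSidedRigidity), ⟹
GeneralizedHardyLittlewood (Green–Tao Conj. 1.2, all d, t, L, convex K). Equivalent to the plain
fixed-shift pairs statement (PairsHL, stmt-Parity-0867; hypothesis of the shared item PairsToGHL of
routes HullDial/LiouvilleMAD/LiouvilleShiftedTables) by Abel summation against 1/(log n·log(n+h))
and the trivial odd shifts (𝔖 = 0; one of n, n+h is a power of 2). Contains: prime k-tuples for k ≥
3 at fixed shifts (a k-fold rigidity would first need 'tuple-GEH'), general slopes, shift-uniformity
|b_i| ≤ LN (Landau–Siegel-hard: a Siegel zero mod q forces ΣΛ(n)Λ(n+q) ≈ 2𝔖_q x,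
MatomakiMerikoski2023 Thm 1.3) and the fibration d ≥ 2 ⇐ d = 1 (route DicksonFibration, provable).
Staffed last: grounders stamp, provers should not spend effort before
RoughSemiprimeTwins/TwoSidedRigidity move. It replaces, on this route only, PairsToGHL
(stmt-Parity-9389, kept by its three other routes) and the support PairsAssembly, so that no support
is a hypothesis of `closes`. [difficulty: open-problem] (why it might fail: an implication between
open conjectures, provable only by proving GHL outright: fixed-shift pairs give no known leverage on
k ≥ 3 tuples or general slopes, and shift-uniformity is Landau–Siegel-hard.) [GreenTao2010,
MatomakiMerikoski2023, HardyLittlewood1923]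
#9 EH (crux; conjecture-grade, consumed by `closes` through TwoSidedRigidity's antecedent) — the
Elliott–Halberstam conjecture spelled out verbatim over Mathlib: ∀ θ < 1, ∀ A, ε > 0: Σ_{q ≤
x^{θ−ε}} max_{1≤y≤x} max_{(a,q)=1} |ψ(y;q,a) − y/φ(q)| ≪ x (log x)^{−A} (`Iff.rfl` with
Literature.NumberTheory.Sieve.LevelOfDistribution.ElliottHalberstam). Follows from GEH by
GEHtoEH.primesHaveLevel_of_forall_geh (Polymath 8b Prop. 2.7). No prover effort. [difficulty:
open-problem] (why it might fail: open for every θ > ½ (Bombieri–Vinogradov gives θ < ½ only; BFI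
reach 4/7 only for well-factorable weights and fixed residue); the endpoint θ = 1 is false
(Friedlander–Granville 1989: moduli x/(log x)^B), so x^{1−ε} for every ε is the strongest form that
can hold.) [ElliottHalberstam1970, Polymath8b2014, FriedlanderGranville1989]
#9 GEH (crux; conjecture-grade; the named condition of the route, NOT a hypothesis of `closes`) — ∀
θ < 1, Literature.NumberTheory.Sieve.GeneralizedElliottHalberstam θ (Polymath 8b, arXiv:1407.4897,
Claim 2.6, BY NAME: divisor-bounded α, β at scales x^ε ≤ N, M ≤ x^{1−ε}, NM ≍ x, β Siegel–Walfisz ⟹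
Σ_{q ≤ x^θ} max_a |Δ(α⋆β; a (q))| ≪_A x (log x)^{−A}); `Iff.rfl`-equal to the verbatim antecedent of
GEHGivesRoughBombieri, so GEH ∧ GEHGivesRoughBombieri ⟹ RoughSemiprimeBombieri (certified,
Sketch.lean): it is the standard conjecture of which the consumed crux is an instance, and the
upgrade path for `closes` once the support is proved. ∀ θ < 1 because (A₂) needs level x^{1−ε} for
every ε. No prover effort. [difficulty: open-problem] (why it might fail: proved only for θ < ½
(Motohashi; Polymath 8b Thm 2.7(iii)), open beyond; the EH endpoint θ = 1 is false
(Friedlander–Granville 1989), and the ∀θ<1 bilinear form could fail the same way as θ → 1.)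
[Polymath8b2014, arXiv:1407.4897, FriedlanderGranville1989, FriedlanderGranvilleHildebrandMaier1991,
BombieriFriedlanderIwaniecActa1986, ElliottHalberstam1970]
#9 GEHGivesRoughBombieri (support, L) — (∀ θ < 1, GEH[θ] verbatim, Δ = apDiscrepancy inlined) → for
every even h, n ↦ W(n+h) with density g(d) = 1_{(d,h)=1}/φ(d) carries Bombieri data (X, g) with
constant 𝔖({0,h}). Bookkeeping: the congruence sums of W(·+h) are sums over (1+δ)-adic boxes of α⋆β
with α, β prime-supported at scales in [x^{1/4}, x^{3/4}] (Siegel–Walfisz for β is a theorem);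
Polymath's coprime-mean discrepancy equals the 1/φ(d)-model up to ≪ x^{3/4+o(1)}; classes with (d,h)
> 1 carry O_h(1); the sup over y ≤ x and the polylogarithmic number of boxes are absorbed by a
diagonal trick (the tree's GEH quantifies over arbitrary scale functions and x-indexed coefficient
families). [Polymath8b2014, arXiv:1407.4897, BombieriRIMS1977]
#9 BombieriRoughP2Law (support, L; KNOWN — Bombieri's general-weights theorem, r = 2, RIMS 1977 p. 5
/ survey p. 39, vendored as Bombieri1976_P2Distribution) — for every sequence a with Bombieri data
(X, g) and constant H: Σ_{n≤x} W(n)a_n = H·X(x) log x − ½Σ_{p≤x} log²p·a_p + o(X(x) log x): the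
affine one-scalar law for W (W⁺ = W⁻ = 1 − 2η = ½), the balanced weight W + ½·log²·1_P being the W⁻
= 0 case. Proof route: [B2]'s reduction to standard weights, reusing the tree's FI1978 Lemmata 3–12
toolkit. [BombieriAsymptoticSieve1976, BombieriRIMS1977, doi:10.1016/b978-0-12-067570-8,
FriedlanderIwaniecPisa1978]
#9 ShiftedPrimesBombieri (support, M) — EH (verbatim) → for every even h the sequence c_m =
log²(m−h)·1_{m−h prime} (m > h), density 1_{(d,h)=1}/φ(d), carries Bombieri data with constant
𝔖({0,h}) — the negative-shift, log²-weighted, general-even-h analogue of the tree's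
hasLevelOfDistribution_shiftedPrimes_of_primesHaveLevel_holds and
bombieri_asymptotic_sieve_shiftedPrimes_holds. [BombieriRIMS1977, HalberstamRichert1974,
ElliottHalberstam1970]
DROPPED in the g3 repair (2026-08-16): PairsToGHL (stmt-Parity-9389 — from this route only; replaced
by WeightedPairsToGHL), PairsAssembly (stmt-Parity-11313 — its little-o subtraction is now the body
of `closes` and its Abel-summation/odd-shift passage is inside WeightedPairsToGHL's hypothesis form;
provable but no longer load-bearing); the Assembly item was restated to the type of the new
`closes`. Dropped earlier (badge repair): PairsHL (stays TauberianTwins' stmt-Parity-0867) and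
RankUniformLambdaK (stmt-Parity-11308, open side question).

TWO-LAYER PLAN. TwoSidedRigidity ⇐ NearSideLaw (BombieriRoughP2Law at (W(·+h), X, g), plus X(N) = ½N
log N + O(N)) → FarSideLaw (Σ_p log²p·W(p+h) = 𝔖N log²N − ½U_h(N) + o, from ShiftedPrimesBombieri +
BombieriRoughP2Law) → TwoSidedRigidity. BombieriRoughP2Law ⇐ BalancedAsymptotic (the W⁻ = 0 case for
W + ½log²·1_P, = Bombieri1976_P2Distribution at r = 2) → LinearityStep → law. RoughSemiprimeBombieri
⇐ GEH (crux, by name) + GEHGivesRoughBombieri (support) — already items. RoughSemiprimeTwins ⇐ (if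
attacked head-on) BalancedBoxes (all four primes in [N^{1/4}, N^{3/4}] with commensurable sizes: DFI
determinant method + bilinear Kloosterman forms) → UnbalancedBoxes → glue. WeightedPairsToGHL ⇐
(only after the pairs side moves) WeightedPairsToDimOne (needs tuple-GEH versions of every item,
general slopes, shift-uniformity) → DimOneToGHL (the fibration d ≥ 2 ⇐ d = 1, route
DicksonFibration's provable part, shared by signature).

KILL CRITERIA. RoughSemiprimeTwins refuted for one even h ⇒ given EH ∧ RoughSemiprimeBombieri (≤
GEH), HL(h) is false: close `refuted:RoughSemiprimeTwins` (summit-level news; hand the witness to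
the refuters of TauberianTwins.PairsHL). TwoSidedRigidity refuted ⇒ the composition of the two
affine laws is wrong: add a repaired statement with the corrected coefficient and re-certify
`closes` if the witness is a normalisation / secondary-term issue (the one-parameter structure
survives), close if rough weights genuinely carry a second free parameter. BombieriRoughP2Law
refuted as typed ⇒ restate from [B2]'s exact normalisation; route survives. EH, GEH or
RoughSemiprimeBombieri refuted AS TYPED ⇒ class misstated (normalisation of the inlined
Polymath/Bombieri hypotheses): add the repaired statement as a new item and re-certify `closes`;
class substantive (GEH-type level-1 input false for W(·+h)) ⇒ the line's hypotheses are gone: close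
`refuted:<item>`. Fixed-shift (log-weighted or plain) pairs proved by another route ⇒ the route
reduces to WeightedPairsToGHL: close `superseded --by` that route unless TwoSidedRigidity is still
wanted as a theorem. WeightedPairsToGHL cannot be refuted without refuting GHL itself (then the
sub-problem closes `refuted`); it is never a reason to pivot this route and gets no prover effort
before the rank-2/3 cruxes move.

NOT DECOMPOSED YET. The card's sensitivity index (R2) — which ζ^z⊗ζ^w shifted convolution sums are
parity-blind (polar divisor of Γ(−z)Γ(−w)); it retrodicts Drappeau–Topacogullari's solved line
(z,2), arXiv:1807.09569 — needs τ_z for complex z and is explanatory, not load-bearing. General η ∈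
(0,½) and general anatomy cells (every bounded cell = K + κ·twin cell, κ = product of the two W⁻).
k-tuples (t-fold cells, one free parameter per d = 1 system) and the passage to d = 1 GHL and beyond
(route DicksonFibration; shift-uniformity is Siegel-hard). FractionalChowla(r) (card Crux 3) waits
on rank-uniformity of Bombieri's Λ_k-law (dropped side item RankUniformLambdaK; a Ford2004-type
sequence may refute it as typed). Uniform-in-p Bombieri for the family n ↦ Λ((n+h)/p)1_{p∣n+h}, p ≤
x^η, which would give the full (Λ⋆Λ)⊗(Λ⋆Λ) cell S₂₂ ∼ 4𝔖x log²x, is left for layer 2 (the vendored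
vector form Bombieri1976_asymptotic_sieve_vector is the tool). WeightedPairsToGHL is deliberately
not split (k-fold rigidity needs tuple-GEH hypotheses and a shift-uniform, slope-general version of
every item; DicksonFibration owns d ≥ 2).

CHEAPEST FALSIFIER. Numerics of the copy law, now run by refuters to N = 10⁹ (evidence on
TwoSidedRigidity / RoughSemiprimeTwins: RoughTwinsNumerics.md, out_1e9 table; kit jobs at 10⁸–10¹⁰
queued): C_h/(¼U_h) = 0.959 at 10⁹ rising as 1 − c/log N, (C_h − ¼U_h)/(N log²N) = −0.039 → −0.012
(10⁶ → 10⁹) shrinking monotonically and h-independently, C_h against the HL heuristic with the exact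
local W-density = 0.9978 for all h ∈ {2,…,30}, prime-pair sanity V_h/(𝔖N) = 1.000 ± 0.001 — the
whole finite-N deficit is the one-point lag E[W(m)]/(½ log m) = 1 − O(1/log m) (Mertens), nothing
points away from coefficient ¼ or from 𝔖({0,h}). What would still kill cheaply: a fitted limit of
C_h/(¼U_h) visibly ≠ 1 in the 10¹⁰ runs (kills TwoSidedRigidity as typed), or of C_h/(¼𝔖N log²N) ≠ 1
(kills RoughSemiprimeTwins numerically). Lookup falsifier: Murty–Vatwani 2018 (zbl:1425.11163) or
Opera de Cribro Ch. 3 (not held) may already print a two-sided (R1)-type equivalence — then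
TwoSidedRigidity is 'known' (re-badge support) and the route shrinks to its conjecture-grade cruxes
plus RoughSemiprimeTwins.

NUMBERS. η = ¼: W⁺(W) = W⁻(W) = 1 − 2η = ½; copy coefficient (1−2η)² = ¼; Σ_{n≤N}W(n) = ½N log N +
O(N). Evans 2022 (arXiv:2102.12297): E₂×E₂ HL-asymptotic with 𝔖(h) for all but O(H log^{−η}X) shifts
|h| ≤ H, log^{19+ε}X ≤ H ≤ X log^{−A}X; prime × E₂ for H ≥ X^{1/6+ε}; primes: H ≥ X^{8/33+ε}
(Matomäki–Radziwiłł–Tao). GEH[θ] is a theorem for θ < ½ (Motohashi; Polymath 8b Thm 2.7(iii)) and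
open for every θ > ½; the endpoint θ = 1 of EH is false (Friedlander–Granville). Bombieri's
indeterminacy: α ∈ [0,2], every value realised (tree bombieri_asymptotic_sieve_indeterminacy_holds).
Items after the g3 repair: 10 (6 cruxes — RoughSemiprimeTwins r2, TwoSidedRigidity r3,
WeightedPairsToGHL r8, and the conjecture-grade RoughSemiprimeBombieri, EH, GEH at ledger rank 9 —
plus 3 supports and the Assembly item = the type of `closes`) + the proved crux-only `closes` (5
hypotheses); explicit imports Literature.NumberTheory.Sieve.SingularSeries (+ the gate's auto-import
Literature.NumberTheory.Sieve.LevelOfDistribution for the by-name GEH decl and the conditional_on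
premise; decl-level cone 0 unproved — the module-cone fact bfi_wellFactorable_level rides only on
that auto-import and is used by no item: needs-fact NONE).

DEFINITION REQUESTS. None: W is inlined as a `let` in each declaration. If the route grows: `--kind
definition --notion RoughSemiprimeWeight --topic Literature/NumberTheory/Sieve` (W with general η)
and `--notion DivisorPowerTau --topic Literature/NumberTheory/LFunctions` (τ_z, z ∈ ℂ, for the
sensitivity index). OPERATOR (repeated from g2/rrepair-g3, the only residual blockers no planner
verb can touch): (i) clear or re-audit the bridge-only hold — the condition
GeneralizedElliottHalberstam IS the crux GEH (by name) and its consumed instance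
RoughSemiprimeBombieri is a crux hypothesis of `closes`; (ii) clear conditional_on (or move
GeneralizedElliottHalberstam + apDiscrepancy to a module free of bfi_wellFactorable_level) so that
the LevelOfDistribution auto-import and its unrelated unproved module-cone facts leave this route's
cone.

Novelty: Searches (2026-08-15): lit search --source zbmath ×8 ("Bombieri asymptotic sieve" → zbl:0422.10042,
zbl:0415.10040, zbl:0396.10037; "twin almost primes asymptotic formula" → 6 generic; "correlations
of almost primes" → arXiv:2102.12297, doi:10.1007/s00209-018-2177-z; "remark on a conjecture of
Chowla Murty Vatwani" → zbl:1425.11163; "switching principle sieve theory Fouvry Grupp" →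
zbl:0588.10051; "Affine linear sieve expanders sum-product" → doi:10.1007/s00222-009-0225-3;
"quadratic divisor problem determinant equation" → 0; "asymptotic sieve ... generalized von
Mangoldt" → 0); lit vsearch "Bombieri asymptotic sieve hypotheses (A1)-(A5) ..." (→
book:friedlandernd-analytic-number-theory p. 21, READ); lit read doi:10.1016/b978-0-12-067570-8 pp.
36–42 (general-weights theorem pp. 39–40, READ); lit read arXiv:2102.12297 pp. 1–4 (READ); lit read
arXiv:2603.13416 pp. 1–3; lit frontier Parity --since 2020 (30 rows: nothing on two-sided sieves /
almost-prime twin tables); lit bridges Parity --cross any (30 rows, generic monographs); lit galaxy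
search "matrices with prime entries" --star all (1 irrelevant panama hit; pdf/crabby queued out);
local searchd down (connection reset ×3), OpenAlex budget exhausted and arXiv HTTP 429 — recorded as
not consulted; ledger negatives --problem Parity (0 refuted); lit read paper:w2557492421 (Vatwani
2016 thesis, 194 pp., grep Bombieri/almost prime/parity: Ch. 7 = one-sided CE(θ)+EH ⟹ twins, Ch. 4.2
= almost-prime k-tuple lower bounds; no two-sided  [refs: 10.1007/s00209-018-2177-z, 10.1007/s00222-009-0225-3, 10.1016/b978-0-12-067570-8, 2102.12297, 2603.13416, doi:10.1007/s00209-018-2177-z, doi:10.1007/s00222-009-0225-3, book:friedlandernd-analytic-number-theory, doi:10.1016/b978-0-12-067570-8, paper:w2557492421, BombieriAsymptoticSieve1976, MurtyVatwani2017]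

Barriers (technique_class: asymptotic-sieve generalized-elliott-halberstam two-sided): - technique_class: asymptotic-sieve generalized-elliott-halberstam two-sided
- Literature.Barriers.Parity.SelbergParityBarrier: not evaded but USED — the one free parameter of
Bombieri's indeterminacy (tree bombieri_asymptotic_sieve_indeterminacy_holds) is the engine; the
route never derives HL from Type-I data: it proves that Type-I data (EH, GEH) make the
rough-semiprime cell and the prime cell interchangeable and pays the parity input at the non-sieve
statement RoughSemiprimeTwins.
- Literature.Barriers.Parity.FordFixedLevelBarrier: every sieve step assumes level x^{1−ε} for EVERY
ε ((A₂) inside IsBombieriSequence), never a fixed level ν < 1; Ford's k-dependence is exactly the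
declared risk of RankUniformLambdaK, which the Assembly does not use.
- Literature.Barriers.Parity.PrimePairParity: consistent — no weight-insertion-invariant deduction
of a positive prime-pair count from (G)EH is attempted; Polymath's (1 − λ(n)λ(n+2))-twisted model is
precisely the α_h-direction the rank-one law leaves free, and under GEH alone the route outputs an
EQUIVALENCE (cell ⟺ HL), the positive input being RoughSemiprimeTwins.
- Literature.Barriers.Parity.LogarithmicAveraging: respected — all cells are Cesàro
(natural-density) statements; nothing log-averaged is fed through the table (twin primes contribute
O(1) to Σμ(n)μ(n+h)/n, invisible at o(log x)).
- Literature.Barriers.Parity.EquidistributionLimitBarrier: EH/GEH are used in the x^{θ−ε} forms of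
the tree (ElliottHalberstam, GeneralizedE

History (route lifecycle, newest last):
- 2026-08-16T03:09:02Z · rev 6: dropped stmt-Parity-9387, stmt-Parity-11308 — route-repair (badge, D-0027 §2.2 / hold bridge-only): clear the conditional-bridge declaration on Literature.NumberTheory.Sieve.GeneralizedElliottHalberstam (no (planner-rbadge-Parity-RoughSemiprimeRigidity-0c478593-0)
- 2026-08-16T03:17:29Z · rev 6: dropped stmt-Parity-9387, stmt-Parity-11308 — route-repair (badge, D-0027 §2.2 / hold bridge-only): clear the conditional-bridge declaration on Literature.NumberTheory.Sieve.GeneralizedElliottHalberstam (no (planner-rbadge-Parity-RoughSemiprimeRigidity-0c478593-0)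
- 2026-08-16T04:02:17Z · rev 9: restated Assembly (stmt-Parity-14175) — route-repair (cone guardrail g2 + badge bridge-only), step 1/2: (i) CLEAR the conditional-bridge declaration (conditional_bridge=false, conditional_on cleared): (planner-rbadge-Parity-RoughSemiprimeRigidity-0c478593-g2-0)
- 2026-08-16T06:42:13Z · rev 10: restated Assembly (stmt-Parity-14601) — route-repair g3 (glue.non-crux-hypothesis + bridge-only; cone guardrail): CRUX-ONLY deciding theorem. closes : TwoSidedRigidity → EH → RoughSemiprimeBombieri → (planner-rbadge-Parity-RoughSemiprimeRigidity-0c478593-g3-0)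
- 2026-08-16T06:42:13Z · rev 10: dropped stmt-Parity-9389, stmt-Parity-11313 — route-repair g3 (glue.non-crux-hypothesis + bridge-only; cone guardrail): CRUX-ONLY deciding theorem. closes : TwoSidedRigidity → EH → RoughSemiprimeBombieri → (planner-rbadge-Parity-RoughSemiprimeRigidity-0c478593-g3-0)
- 2026-08-24T05:00:55Z · DORMANT — reconciler: no traction for 6.6 d (last activity item-evidence-added at 2026-08-17T15:04:20Z); parked, not closed — `ledger route dormant route-Parity-RoughSemi (operator:999:3050329)
- 2026-08-29T05:53:06Z · REACTIVATED — reconciler: reactivated — activity statement-checked at 2026-08-29T02:47:45Z after parking at 2026-08-24T05:00:55Z (operator:999:1724610)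
- 2026-09-03T09:08:04Z · DORMANT — reconciler: no traction for 5 d (last activity statement-checked at 2026-08-29T08:32:56Z); parked, not closed — `ledger route dormant route-Parity-RoughSemiprim (operator:999:3241383)

sub-problem: GeneralizedHardyLittlewood · status: dormant · opened planner-plancard-Parity-GeneralizedHardyLittl-ad6cc296-0 2026-08-15T13:56:45Z · rev 10 · ledger route-Parity-RoughSemiprimeRigidity
GENERATED by the gate from the ledger (D-0016/17). Provers cite these decls: `theorem foo : Summit.Parity.GeneralizedHardyLittlewood.Theses.RoughSemiprimeRigidity.<Decl> := …` in Summits/Parity/GeneralizedHardyLittlewood/Theorems/<Name>.lean.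
-/

namespace Summit.Parity.GeneralizedHardyLittlewood.Theses.RoughSemiprimeRigidity

open scoped BigOperators Topology Manifold Classical MeasureTheory ProbabilityTheory Matrix InnerProductSpace ComplexConjugate ContinuousMap
open Filter Set Function TopologicalSpace MeasureTheory

attribute [summit_statement] _root_.GeneralizedHardyLittlewood
attribute [route_premise "route-Parity-RoughSemiprimeRigidity"] _root_.Literature.NumberTheory.Sieve.GeneralizedElliottHalberstam

/-- item stmt-Parity-9380 · crux · rank 2 · open · by planner
why it might fail: Fixed-h binary problem, HL-equivalent under EH+GEH by this very route (W⁻W⁻ = ¼ ≠ 0, parity-sensitive); only averaged-over-h versions are theorems (Evans 2022, H ≥ log^19 X); dispersion in q reduces it to P₂-pair problems of the same binary type.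
sources: arXiv:2102.12297, Polymath8b2014, BourgainGamburdSarnak2009, HardyLittlewood1923, arXiv:2603.13416
[crux] for every even h ≥ 2: Σ_{n≤N} W(n)W(n+h) = ¼·𝔖({0,h})·N log²N + o(N log²N), where W(m) = 2
log q log p for m = qp with primes m^{1/4} < q < p and W = 0 otherwise (card
geh-rigidity-twin-table, 'one interior point' = the (2,2) cell in its rough form). By
TwoSidedRigidity it is EQUIVALENT to HL(h) under EH+GEH; unconditionally its averaged-over-h form is
Evans's theorem. [difficulty: open-problem] -/
@[route_item "route-Parity-RoughSemiprimeRigidity"]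
def RoughSemiprimeTwins : Prop :=
  let W : ℕ → ℝ := fun m => ∑ q ∈ m.primeFactors, if (m / q).Prime ∧ q < m / q ∧ m < q ^ 4 then 2 * Real.log q * Real.log ((m / q : ℕ) : ℝ) else 0; ∀ h : ℕ, 1 ≤ h → Even h → (fun N : ℕ => ∑ n ∈ Finset.Icc 1 N, W n * W (n + h) - (1 / 4 : ℝ) * Literature.NumberTheory.Sieve.singularSeries ({0, (h : ℤ)} : Finset ℤ) * N * Real.log N ^ 2) =o[Filter.atTop] fun N : ℕ => (N : ℝ) * Real.log N ^ 2

-- earlier TwoSidedRigidity (stmt-Parity-9381, replaced 2026-08-15T17:01:27Z -> stmt-Parity-11307): retired by None — let W : ℕ → ℝ := fun m => ∑ q ∈ m.primeFactors, if (m / q).Prime ∧ q < m / q ∧ m < q ^ 4 then 2 * Real.log q * Real.log ((m / q : ℕ) : ℝ) else 0; Literature.NumberTheory.Sieve.LevelOfDistribution.ElliottHalberstam → ∀ h : ℕ, 1 ≤ h → Even h → ∀ A : Literature.NumberTheory.Sieve.SieveSe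
/-- item stmt-Parity-11307 · crux · rank 3 · open · by planner
why it might fail: Rests on Bombieri's general-weights law for the sharp-cutoff weight W ([B2] 1976, read only via the 1989 survey) with error o(A log x) at size ≍ x log x; a secondary term of the cutoff q > m^{1/4} or of (A₄) could shift the coefficient ¼ (numerics, N = 4·10⁵: ΣWW/(¼U) = 0.80, rising).
sources: BombieriAsymptoticSieve1976, doi:10.1016/b978-0-12-067570-8, FriedlanderIwaniecPisa1978, Friedlander2006ProducingPrimes, Polymath8b2014
[crux] EH → for every even h and every Bombieri structure (X, g) on n ↦ W(n+h) with constant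
𝔖({0,h}) (Bombieri's (A₁)–(A₅), size = counting function; INLINED VERBATIM over Mathlib (cone repair
2026-08-15): a 'Bombieri structure on f with constant H' is data (X, g) — X : ℝ → ℝ the counting
function, g a multiplicative ArithmeticFunction density — with f ≥ 0, X(x) = Σ_{m≤x} f(m),
Bombieri's (A₁)–(A₅) and the ordered Euler product for H, i.e. by `Iff.rfl` the conjunction
g.IsMultiplicative ∧ f ≥ 0 ∧ A.IsBombieriSequence ∧ A.HasDensityConstant H for A = ⟨f, _, X, g, _⟩ :
Literature.NumberTheory.Sieve.SieveSequence (certificate Equiv.lean, attached); EH is spelled out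
verbatim (`Iff.rfl` with Literature.NumberTheory.Sieve.LevelOfDistribution.ElliottHalberstam = item
EH)): Σ_{n≤N} W(n)W(n+h) − ¼·Σ_{n≤N} Λ(n) log n · Λ(n+h) log(n+h) = o(N log²N). Proof plan (supports
only): BombieriRoughP2Law at (W(·+h), X, g) gives Σ W(n)W(n+h) = 𝔖 X(N) log N − ½Σ_p log²p·W(p+h) +
o(N log²N) with X(N) = ½N log N + O(N) (Mertens/PNT); ShiftedPrimesBombieri + BombieriRoughP2Law at
c_m = log²(m−h)1_P(m−h) give Σ_p log²p·W(p+h) = 𝔖 N log²N − ½U(N) + o(N log²N), U = the log-weighted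
twin sum; substitute: ½𝔖N -/
@[route_item "route-Parity-RoughSemiprimeRigidity"]
def TwoSidedRigidity : Prop :=
  let W : ℕ → ℝ := fun m => ∑ q ∈ m.primeFactors, if (m / q).Prime ∧ q < m / q ∧ m < q ^ 4 then 2 * Real.log q * Real.log ((m / q : ℕ) : ℝ) else 0; let IsBomb : (ℕ → ℝ) → (ℝ → ℝ) → ArithmeticFunction ℝ → ℝ → Prop := fun a X g H => let R : ℕ → ℝ → ℝ := fun d x => (∑ n ∈ (Finset.Ioc 0 ⌊x⌋₊).filter (d ∣ ·), a n) - g d * X x; g.IsMultiplicative ∧ (∀ n : ℕ, 0 ≤ a n) ∧ ((∀ x : ℝ, X x = ∑ n ∈ (Finset.Ioc 0 ⌊x⌋₊).filter (1 ∣ ·), a n) ∧ ((∀ ε : ℝ, 0 < ε → ∃ C : ℝ, ∀ d : ℕ, 1 ≤ d → |g d| ≤ C * (d : ℝ) ^ (-1 + ε)) ∧ ∀ d : ℕ, 1 < d → g d < 1) ∧ (∀ ε : ℝ, 0 < ε → ∀ B : ℝ, 0 < B → ∃ C : ℝ, ∀ᶠ x : ℝ in Filter.atTop, ∀ y : ℕ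 → ℝ, (∀ d, y d ≤ x) → ∑ d ∈ Finset.Ico 1 ⌈x ^ (1 - ε)⌉₊, |R d (y d)| ≤ C * X x / Real.log x ^ B) ∧ (∃ (F : ℕ → ℝ) (c₁ c₂ : ℝ), 0 < c₁ ∧ 0 < c₂ ∧ (∀ ε : ℝ, 0 < ε → ∃ C : ℝ, ∀ d : ℕ, 1 ≤ d → |F d| ≤ C * (d : ℝ) ^ ε) ∧ ((fun x : ℝ => ∑ d ∈ Finset.Ico 1 ⌈x⌉₊, F d ^ 2 / d) =O[Filter.atTop] fun x : ℝ => Real.log x ^ c₂) ∧ ∃ C : ℝ, ∀ᶠ x : ℝ in Filter.atTop, ∀ d : ℕ, 1 ≤ d → (d : ℝ) < x → |R d x| ≤ C * (F d / d) * X x * Real.log x ^ c₁) ∧ (((fun x : ℝ => ∫ t in (1 : ℝ)..x, X t / t) =o[Filter.atTop] fun x : ℝ => X x * Real.log x) ∧ (fun x : ℝ => X (Real.sqrt x)) =o[Filter.atTop] fun x : ℝ => X x / Real.log x) ∧ (∃ η₁ : ℝ, 0 < η₁ ∧ ∃ b : ℕ → ℂ, (∀ s : ℂ, -η₁ < s.re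 → LSeriesSummable b s) ∧ LSeries b 0 ≠ 0 ∧ ∀ s : ℂ, 0 < s.re → LSeries (fun d => ((g d : ℝ) : ℂ)) s = riemannZeta (s + 1) * LSeries b s)) ∧ Filter.Tendsto (fun x : ℕ => ∏ p ∈ Nat.primesLE x, (1 - g p) / (1 - (p : ℝ)⁻¹)) Filter.atTop (nhds H); (∀ θ : ℝ, θ < 1 → ∀ A : ℝ, 0 < A → ∀ ε : ℝ, 0 < ε → (fun x : ℝ => ∑ q ∈ Finset.Icc 1 ⌊x ^ (θ - ε)⌋₊, ⨆ y : ↥(Set.Icc (1 : ℝ) x), ⨆ a : (ZMod q)ˣ, |(∑ n ∈ Finset.range (⌊(y : ℝ)⌋₊ + 1), ArithmeticFunction.vonMangoldt.residueClass (a : ZMod q) n) - (y : ℝ) / (Nat.totient q : ℝ)|) =O[Filter.atTop] fun x : ℝ => x / Real.log x ^ A) → ∀ h : ℕ, 1 ≤ h → Even h → ∀ (X : ℝ → ℝ) (g : ArithmeticFunction ℝ), IsBomb (fun n : ℕ => W (n + h)) X g (Literature.NumberTheory.Sieve.singularSeries ({0, (h : ℤ)} : Finset ℤ)) → (fun N :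 ℕ => ∑ n ∈ Finset.Icc 1 N, W n * W (n + h) - (1 / 4 : ℝ) * ∑ n ∈ Finset.Icc 1 N, ArithmeticFunction.vonMangoldt n * Real.log n * (ArithmeticFunction.vonMangoldt (n + h) * Real.log ((n + h : ℕ) : ℝ))) =o[Filter.atTop] fun N : ℕ => (N : ℝ) * Real.log N ^ 2

/-- item stmt-Parity-14888 · crux · rank 8 · open · by planner
why it might fail: Implication between open conjectures, provable only by proving GHL outright: fixed-shift pairs give no leverage on k ≥ 3 tuples or general slopes; shift-uniformity |b_i| ≤ LN is Landau–Siegel-hard (Siegel zero mod q ⇒ ΣΛ(n)Λ(n+q) ≈ 2𝔖x, Matomäki–Merikoski 2023 Thm 1.3).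
sources: GreenTao2010, MatomakiMerikoski2023, HardyLittlewood1923
[crux] (GHL-hard RESIDUAL, listed so that the deciding theorem `closes` reaches the sub-problem
statement with CRUX hypotheses only, D-0027 §2.1/§2.2; new in the g3 repair 2026-08-16, replacing on
this route the shared item PairsToGHL (stmt-Parity-9389) and the support PairsAssembly) log-weighted
Hardy–Littlewood pairs at every fixed EVEN shift — for every even h ≥ 2, U_h(N) := Σ_{n≤N} Λ(n) log
n · Λ(n+h) log(n+h) = 𝔖({0,h})·N log²N + o(N log²N), the left side VERBATIM the twin sum of
TwoSidedRigidity and 𝔖 = Literature.NumberTheory.Sieve.singularSeries — ⟹ GeneralizedHardyLittlewood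
(Green–Tao 2010 Conj. 1.2: all d, t, L, convex K). Equivalent to the plain fixed-shift pairs
statement Σ_{n≤N} Λ(n)Λ(n+h) = 𝔖({0,h})N + o(N) ∀ h ≥ 1 (PairsHL, TauberianTwins' stmt-Parity-0867;
the hypothesis of PairsToGHL) by Abel summation against the decreasing weights 1/(log n·log(n+h))
and the trivial odd shifts (𝔖({0,h}) = 0 and one of n, n+h is a power of 2). Contains: prime
k-tuples for every k ≥ 3 at fixed shifts (a k-fold version of the rigidity would first need
'tuple-GEH'), general slopes a_i n + b_i, shift-uniformity |b_i| ≤ LN (Landau–Siegel-hard,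
MatomakiMerikoski2023 Thm 1.3) and the fib -/
@[route_item "route-Parity-RoughSemiprimeRigidity"]
def WeightedPairsToGHL : Prop :=
  (∀ h : ℕ, 1 ≤ h → Even h → (fun N : ℕ => ∑ n ∈ Finset.Icc 1 N, ArithmeticFunction.vonMangoldt n * Real.log n * (ArithmeticFunction.vonMangoldt (n + h) * Real.log ((n + h : ℕ) : ℝ)) - Literature.NumberTheory.Sieve.singularSeries ({0, (h : ℤ)} : Finset ℤ) * N * Real.log N ^ 2) =o[Filter.atTop] fun N : ℕ => (N : ℝ) * Real.log N ^ 2) → GeneralizedHardyLittlewood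

-- earlier RoughSemiprimeBombieri (stmt-Parity-9383, replaced 2026-08-15T17:01:27Z -> stmt-Parity-11309): retired by None — let W : ℕ → ℝ := fun m => ∑ q ∈ m.primeFactors, if (m / q).Prime ∧ q < m / q ∧ m < q ^ 4 then 2 * Real.log q * Real.log ((m / q : ℕ) : ℝ) else 0; ∀ h : ℕ, 1 ≤ h → Even h → ∃ A : Literature.NumberTheory.Sieve.SieveSequence, A.a = (fun n : ℕ => W (n + h)) ∧ A.IsBombieriSequence ∧ 
/-- item stmt-Parity-11309 · crux · rank 9 · open · by planner
why it might fail: GEH-strength claim for one explicit sequence: level x^{1−ε} for every ε (sup over y ≤ x) for shifted rough semiprimes is open beyond level ½ (known: ½; 4/7 only with well-factorable weights); the crude (A₃) remainder and the (A₅) continuation for g = 1_{(d,h)=1}/φ(d) must also hold as typed.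
sources: Polymath8b2014, arXiv:1407.4897, BombieriRIMS1977, BombieriFriedlanderIwaniecActa1986
[support] (the bridge hypothesis X₁; GEH content) for every even h there is a Bombieri structure (X,
g) on n ↦ W(n+h) — Bombieri's (A₁)–(A₅): size = counting function, level x^{1−ε} for every ε with
sup over y ≤ x, crude pointwise remainders, growth, analytic continuation of the density series —
with constant 𝔖({0,h}); INLINED VERBATIM over Mathlib (cone repair 2026-08-15): a 'Bombieri
structure on f with constant H' is data (X, g) — X : ℝ → ℝ the counting function, g a multiplicative
ArithmeticFunction density — with f ≥ 0, X(x) = Σ_{m≤x} f(m), Bombieri's (A₁)–(A₅) and the ordered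
Euler product for H, i.e. by `Iff.rfl` the conjunction g.IsMultiplicative ∧ f ≥ 0 ∧
A.IsBombieriSequence ∧ A.HasDensityConstant H for A = ⟨f, _, X, g, _⟩ :
Literature.NumberTheory.Sieve.SieveSequence (certificate Equiv.lean, attached). Discharged from GEH
by GEHGivesRoughBombieri; (A₁),(A₃),(A₄),(A₅) are unconditional bookkeeping for the density g(d) =
1_{(d,h)=1}/φ(d). [difficulty: M] -/
@[route_item "route-Parity-RoughSemiprimeRigidity"]
def RoughSemiprimeBombieri : Prop :=
  let W : ℕ → ℝ := fun m => ∑ q ∈ m.primeFactors, if (m / q).Prime ∧ q < m / q ∧ m < q ^ 4 then 2 * Real.log q * Real.log ((m / q : ℕ) : ℝ) else 0; let IsBomb : (ℕ → ℝ) → (ℝ → ℝ) → ArithmeticFunction ℝ → ℝ → Prop := fun a X g H => let R : ℕ → ℝ → ℝ := fun d x => (∑ n ∈ (Finset.Ioc 0 ⌊x⌋₊).filter (d ∣ ·), a n) - g d * X x; g.IsMultiplicative ∧ (∀ n : ℕ, 0 ≤ a n) ∧ ((∀ x : ℝ, X x = ∑ n ∈ (Finset.Ioc 0 ⌊x⌋₊).filter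 (1 ∣ ·), a n) ∧ ((∀ ε : ℝ, 0 < ε → ∃ C : ℝ, ∀ d : ℕ, 1 ≤ d → |g d| ≤ C * (d : ℝ) ^ (-1 + ε)) ∧ ∀ d : ℕ, 1 < d → g d < 1) ∧ (∀ ε : ℝ, 0 < ε → ∀ B : ℝ, 0 < B → ∃ C : ℝ, ∀ᶠ x : ℝ in Filter.atTop, ∀ y : ℕ → ℝ, (∀ d, y d ≤ x) → ∑ d ∈ Finset.Ico 1 ⌈x ^ (1 - ε)⌉₊, |R d (y d)| ≤ C * X x / Real.log x ^ B) ∧ (∃ (F : ℕ → ℝ) (c₁ c₂ : ℝ), 0 < c₁ ∧ 0 < c₂ ∧ (∀ ε : ℝ, 0 < ε → ∃ C : ℝ, ∀ d : ℕ, 1 ≤ d → |F d| ≤ C * (d : ℝ) ^ ε) ∧ ((fun x : ℝ => ∑ d ∈ Finset.Ico 1 ⌈x⌉₊, F d ^ 2 / d) =O[Filter.atTop] fun x : ℝ => Real.log x ^ c₂) ∧ ∃ C : ℝ, ∀ᶠ x : ℝ in Filter.atTop, ∀ d : ℕ, 1 ≤ d → (d : ℝ) < x → |R d x| ≤ C *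 (F d / d) * X x * Real.log x ^ c₁) ∧ (((fun x : ℝ => ∫ t in (1 : ℝ)..x, X t / t) =o[Filter.atTop] fun x : ℝ => X x * Real.log x) ∧ (fun x : ℝ => X (Real.sqrt x)) =o[Filter.atTop] fun x : ℝ => X x / Real.log x) ∧ (∃ η₁ : ℝ, 0 < η₁ ∧ ∃ b : ℕ → ℂ, (∀ s : ℂ, -η₁ < s.re → LSeriesSummable b s) ∧ LSeries b 0 ≠ 0 ∧ ∀ s : ℂ, 0 < s.re → LSeries (fun d => ((g d : ℝ) : ℂ)) s = riemannZeta (s + 1) * LSeries b s)) ∧ Filter.Tendsto (fun x : ℕ => ∏ p ∈ Nat.primesLE x, (1 - g p) / (1 - (p : ℝ)⁻¹)) Filter.atTop (nhds H); ∀ h : ℕ, 1 ≤ h → Even h → ∃ (X : ℝ → ℝ) (g : ArithmeticFunction ℝ), IsBomb (fun n : ℕ => W (n + h)) X g (Literature.NumberTheory.Sieve.singularSeries ({0, (h : ℤ)} : Finset ℤ))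

-- earlier EH (stmt-Parity-9642, replaced 2026-08-15T17:01:27Z -> stmt-Parity-11314): retired by None — Literature.NumberTheory.Sieve.LevelOfDistribution.ElliottHalberstam
/-- item stmt-Parity-11314 · crux (kind.auto-crux: conjecture-grade) · rank 9 · open · by planner
why it might fail: Open for every θ > ½ (Bombieri–Vinogradov gives θ < ½ only; BFI reach 4/7 only for well-factorable weights and fixed residue); the endpoint θ = 1 is false (Friedlander–Granville 1989: moduli x/(log x)^B), so x^{1−ε} for every ε is the strongest form that can hold.
sources: ElliottHalberstam1970, Polymath8b2014, FriedlanderGranville1989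
[support] The Elliott–Halberstam conjecture, spelled out verbatim over Mathlib (∀ θ < 1, ∀ A, ε > 0:
Σ_{q ≤ x^{θ−ε}} max_{1≤y≤x} max_{(a,q)=1} |ψ(y;q,a) − y/φ(q)| ≪ x (log x)^{−A}; `Iff.rfl` with
Literature.NumberTheory.Sieve.LevelOfDistribution.ElliottHalberstam — cone repair 2026-08-15), the
bridge hypothesis X₀, listed as an item so that the deciding theorem `closes` assumes only route
decls (D-0027 §2.1). Named open conjecture: grounders stamp, provers/refuters should not spend
effort. [difficulty: open-problem] -/
@[route_item "route-Parity-RoughSemiprimeRigidity"]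
def EH : Prop :=
  ∀ θ : ℝ, θ < 1 → ∀ A : ℝ, 0 < A → ∀ ε : ℝ, 0 < ε → (fun x : ℝ => ∑ q ∈ Finset.Icc 1 ⌊x ^ (θ - ε)⌋₊, ⨆ y : ↥(Set.Icc (1 : ℝ) x), ⨆ a : (ZMod q)ˣ, |(∑ n ∈ Finset.range (⌊(y : ℝ)⌋₊ + 1), ArithmeticFunction.vonMangoldt.residueClass (a : ZMod q) n) - (y : ℝ) / (Nat.totient q : ℝ)|) =O[Filter.atTop] fun x : ℝ => x / Real.log x ^ A

/-- item stmt-Parity-14176 · crux · rank 9 · open · by planner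
why it might fail: GEH[θ] is proved only for θ < 1/2 (Motohashi; Polymath 8b Thm 2.7(iii)) and open for every θ > 1/2; the EH endpoint θ = 1 is false (Friedlander–Granville 1989: Maier irregularities at level x/log^B x), and the ∀θ<1 bilinear form could fail the same way as θ → 1.
sources: Polymath8b2014, arXiv:1407.4897, FriedlanderGranville1989, FriedlanderGranvilleHildebrandMaier1991, BombieriFriedlanderIwaniecActa1986, ElliottHalberstam1970
[crux] GEH — the generalized Elliott–Halberstam conjecture for EVERY θ < 1 (Polymath 8b,
arXiv:1407.4897, Claim 2.6: for coefficient sequences α, β at scales N, M with x^ε ≤ N, M ≤ x^{1−ε},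
NM ≍ x, divisor-bounded, β Siegel–Walfisz, Σ_{q ≤ x^θ} max_{(a,q)=1} |Δ(α⋆β; a (q))| ≪_A x (log
x)^{−A}), stated BY NAME over the tree predicate
`Literature.NumberTheory.Sieve.GeneralizedElliottHalberstam θ` — the declared bridge conjecture
(conditional_on) of this CONDITIONAL route. Route-choice 2026-08-16, option (a): the named condition
becomes a crux item so that refuter vetting / tiering apply to it, exactly as for EH (auto-crux). It
is definitionally equal (`Iff.rfl`; cone-repair certificate Equiv.lean / ConeRepairCertificate.md)
to the verbatim GEH hypothesis inlined in GEHGivesRoughBombieri, and the deciding theorem now feeds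
it there: closes : TwoSidedRigidity → EH → GEH → GEHGivesRoughBombieri → RoughSemiprimeTwins →
PairsAssembly → PairsToGHL → GeneralizedHardyLittlewood (GEH ∧ GEHGivesRoughBombieri ⟹
RoughSemiprimeBombieri = X₁). ∀ θ < 1 (not one fixed θ) because Bombieri's (A₂) needs level x^{1−ε}
for every ε. NAMED OPEN CONJECTURE (a theorem for θ < 1/2: Motohashi, Polymath 8b Thm -/
@[route_item "route-Parity-RoughSemiprimeRigidity"]
def GEH : Prop :=
  ∀ θ : ℝ, θ < 1 → Literature.NumberTheory.Sieve.GeneralizedElliottHalberstam θ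

-- earlier GEHGivesRoughBombieri (stmt-Parity-9384, replaced 2026-08-15T17:01:27Z -> stmt-Parity-11310): retired by None — let W : ℕ → ℝ := fun m => ∑ q ∈ m.primeFactors, if (m / q).Prime ∧ q < m / q ∧ m < q ^ 4 then 2 * Real.log q * Real.log ((m / q : ℕ) : ℝ) else 0; (∀ θ : ℝ, θ < 1 → Literature.NumberTheory.Sieve.GeneralizedElliottHalberstam θ) → ∀ h : ℕ, 1 ≤ h → Even h → ∃ A : Literature.NumberThe
/-- item stmt-Parity-11310 · support · rank 9 · open · by planner
sources: Polymath8b2014, arXiv:1407.4897, BombieriRIMS1977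
[support] GEH (∀ θ < 1, Polymath 8b Claim 2.6 — spelled out verbatim, `Iff.rfl` with ∀ θ < 1,
Literature.NumberTheory.Sieve.GeneralizedElliottHalberstam θ, Δ = apDiscrepancy inlined) → for every
even h, n ↦ W(n+h) with density g(d) = 1_{(d,h)=1}/φ(d) (pointwise = shiftedPrimesDensity h) carries
a Bombieri structure (X, g) with constant 𝔖({0,h}) (INLINED VERBATIM over Mathlib (cone repair
2026-08-15): a 'Bombieri structure on f with constant H' is data (X, g) — X : ℝ → ℝ the counting
function, g a multiplicative ArithmeticFunction density — with f ≥ 0, X(x) = Σ_{m≤x} f(m),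
Bombieri's (A₁)–(A₅) and the ordered Euler product for H, i.e. by `Iff.rfl` the conjunction
g.IsMultiplicative ∧ f ≥ 0 ∧ A.IsBombieriSequence ∧ A.HasDensityConstant H for A = ⟨f, _, X, g, _⟩ :
Literature.NumberTheory.Sieve.SieveSequence (certificate Equiv.lean, attached)). Bookkeeping, L: the
congruence sums of W(·+h) are sums over (1+δ)-adic boxes of α⋆β with α, β prime-supported at scales
in [x^{1/4}, x^{3/4}] (Siegel–Walfisz for β is a theorem); Polymath's coprime-mean discrepancy
equals the 1/φ(d)-model up to ≪ x^{3/4+o(1)} because both prime factors exceed x^{1/4}; classes with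
(d,h) > 1 carry O_h(1); the sup -/
@[route_item "route-Parity-RoughSemiprimeRigidity"]
def GEHGivesRoughBombieri : Prop :=
  let W : ℕ → ℝ := fun m => ∑ q ∈ m.primeFactors, if (m / q).Prime ∧ q < m / q ∧ m < q ^ 4 then 2 * Real.log q * Real.log ((m / q : ℕ) : ℝ) else 0; let IsBomb : (ℕ → ℝ) → (ℝ → ℝ) → ArithmeticFunction ℝ → ℝ → Prop := fun a X g H => let R : ℕ → ℝ → ℝ := fun d x => (∑ n ∈ (Finset.Ioc 0 ⌊x⌋₊).filter (d ∣ ·), a n) - g d * X x; g.IsMultiplicative ∧ (∀ n : ℕ, 0 ≤ a n) ∧ ((∀ x : ℝ, X x = ∑ n ∈ (Finset.Ioc 0 ⌊x⌋₊).filter (1 ∣ ·), a n) ∧ ((∀ ε : ℝ, 0 < ε → ∃ C : ℝ, ∀ d : ℕ, 1 ≤ d → |g d| ≤ C * (d : ℝ) ^ (-1 + ε)) ∧ ∀ d : ℕ, 1 < d → g d < 1) ∧ (∀ ε : ℝ, 0 < ε → ∀ B : ℝ, 0 < B → ∃ C : ℝ, ∀ᶠ x : ℝ in Filter.atTop, ∀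 y : ℕ → ℝ, (∀ d, y d ≤ x) → ∑ d ∈ Finset.Ico 1 ⌈x ^ (1 - ε)⌉₊, |R d (y d)| ≤ C * X x / Real.log x ^ B) ∧ (∃ (F : ℕ → ℝ) (c₁ c₂ : ℝ), 0 < c₁ ∧ 0 < c₂ ∧ (∀ ε : ℝ, 0 < ε → ∃ C : ℝ, ∀ d : ℕ, 1 ≤ d → |F d| ≤ C * (d : ℝ) ^ ε) ∧ ((fun x : ℝ => ∑ d ∈ Finset.Ico 1 ⌈x⌉₊, F d ^ 2 / d) =O[Filter.atTop] fun x : ℝ => Real.log x ^ c₂) ∧ ∃ C : ℝ, ∀ᶠ x : ℝ in Filter.atTop, ∀ d : ℕ, 1 ≤ d → (d : ℝ) < x → |R d x| ≤ C * (F d / d) * X x * Real.log x ^ c₁) ∧ (((fun x : ℝ => ∫ t in (1 : ℝ)..x, X t / t) =o[Filter.atTop] fun x : ℝ => X x * Real.log x) ∧ (fun x : ℝ => X (Real.sqrt x)) =o[Filter.atTop] fun x : ℝ => X x / Real.log x) ∧ (∃ η₁ : ℝ, 0 < η₁ ∧ ∃ b : ℕ → ℂ, (∀ s : ℂ, -η₁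 < s.re → LSeriesSummable b s) ∧ LSeries b 0 ≠ 0 ∧ ∀ s : ℂ, 0 < s.re → LSeries (fun d => ((g d : ℝ) : ℂ)) s = riemannZeta (s + 1) * LSeries b s)) ∧ Filter.Tendsto (fun x : ℕ => ∏ p ∈ Nat.primesLE x, (1 - g p) / (1 - (p : ℝ)⁻¹)) Filter.atTop (nhds H); let Δ : (ℕ → ℝ) → ℕ → (q : ℕ) → ZMod q → ℝ := fun γ N q a => (∑ n ∈ (Finset.Icc 1 N).filter (fun n : ℕ => (n : ZMod q) = a), γ n) - (∑ n ∈ (Finset.Icc 1 N).filter (fun n : ℕ => n.Coprime q), γ n) / (Nat.totient q : ℝ); (∀ θ : ℝ, θ < 1 → ∀ ε : ℝ, 0 < ε → ∀ A : ℝ, 0 < A → ∀ k : ℕ, ∀ K : ℝ, 1 ≤ K → ∀ N M : ℝ → ℝ, ∀ α β : ℝ → ArithmeticFunction ℝ, (∀ᶠ x in Filter.atTop, x ^ ε ≤ N x ∧ N x ≤ x ^ (1 - ε) ∧ x ^ ε ≤ M x ∧ M x ≤ x ^ (1 - ε)) → (∃ C : ℝ, 1 ≤ C ∧ ∀ᶠ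 x in Filter.atTop, x / C ≤ N x * M x ∧ N x * M x ≤ C * x) → (∀ x, ∀ n : ℕ, (n : ℝ) < N x ∨ K * N x < n → α x n = 0) → (∀ x, ∀ n : ℕ, (n : ℝ) < M x ∨ K * M x < n → β x n = 0) → (∀ᶠ x in Filter.atTop, ∀ n : ℕ, |α x n| ≤ (ArithmeticFunction.sigma 0 n : ℝ) ^ k * Real.log x ^ k ∧ |β x n| ≤ (ArithmeticFunction.sigma 0 n : ℝ) ^ k * Real.log x ^ k) → (∀ B : ℝ, 0 < B → ∃ C : ℝ, ∀ᶠ x in Filter.atTop, ∀ q r : ℕ, 1 ≤ q → 1 ≤ r → ∀ a : (ZMod q)ˣ, |Δ (fun n => if n.Coprime r then β x n else 0) ⌊K * M x⌋₊ q a| ≤ C * (ArithmeticFunction.sigma 0 (q * r) : ℝ) ^ k * M x / Real.log x ^ B) → (fun x : ℝ => ∑ q ∈ Finset.Icc 1 ⌊x ^ θ⌋₊, ⨆ a : (ZMod q)ˣ, |Δ (fun n => (α x * β x) n) ⌊K * K * (N x * M x)⌋₊ q a|) =O[Filter.atTop] fun x : ℝ => x / Real.log x ^ A) → ∀ h : ℕ,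 1 ≤ h → Even h → ∃ (X : ℝ → ℝ) (g : ArithmeticFunction ℝ), (∀ d : ℕ, g d = if d.Coprime h ∧ d ≠ 0 then ((Nat.totient d : ℝ))⁻¹ else 0) ∧ IsBomb (fun n : ℕ => W (n + h)) X g (Literature.NumberTheory.Sieve.singularSeries ({0, (h : ℤ)} : Finset ℤ))

-- earlier BombieriRoughP2Law (stmt-Parity-9385, replaced 2026-08-15T17:01:27Z -> stmt-Parity-11311): retired by None — let W : ℕ → ℝ := fun m => ∑ q ∈ m.primeFactors, if (m / q).Prime ∧ q < m / q ∧ m < q ^ 4 then 2 * Real.log q * Real.log ((m / q : ℕ) : ℝ) else 0; ∀ (A : Literature.NumberTheory.Sieve.SieveSequence) (H : ℝ), A.IsBombieriSequence → A.HasDensityConstant H → (fun x : ℝ => (∑ n ∈ Finset.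
/-- item stmt-Parity-11311 · support · rank 9 · open · by planner
sources: BombieriAsymptoticSieve1976, doi:10.1016/b978-0-12-067570-8, Friedlander2006ProducingPrimes, FriedlanderIwaniecPisa1978
[support] (KNOWN — Bombieri 1976 general-weights theorem [B2], P₂-anatomy case; not yet in the tree,
which has the Λ_k case) for every sequence a with a Bombieri structure (X, g) and constant H
(INLINED VERBATIM over Mathlib (cone repair 2026-08-15): a 'Bombieri structure on f with constant H'
is data (X, g) — X : ℝ → ℝ the counting function, g a multiplicative ArithmeticFunction density —
with f ≥ 0, X(x) = Σ_{m≤x} f(m), Bombieri's (A₁)–(A₅) and the ordered Euler product for H, i.e. by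
`Iff.rfl` the conjunction g.IsMultiplicative ∧ f ≥ 0 ∧ A.IsBombieriSequence ∧ A.HasDensityConstant H
for A = ⟨f, _, X, g, _⟩ : Literature.NumberTheory.Sieve.SieveSequence (certificate Equiv.lean,
attached)): Σ_{n≤x} W(n)a_n = H·X(x) log x − ½Σ_{p≤x} log²p·a_p + o(X(x) log x). This is the affine
one-scalar law for W: W⁺(W) = W⁻(W) = 1 − 2η = ½ in Bombieri's T₁^±(w) = W⁺ ± |W⁻|, obtained by
linearity from the BALANCED weight W + ½·log²·1_P (W⁻ = 0, for which [B2] gives the asymptotic: 'If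
W⁻ = 0 we get asymptotics', survey p. 40); checks: integers ΣW = ½x log x, 1+λ gives x log x, 1−λ
gives 0. Proof route: [B2] §§ (reduction to standard weights, Selberg Λ² sieve), reusing the tree's
FI1978 Lemmata 3–1 -/
@[route_item "route-Parity-RoughSemiprimeRigidity"]
def BombieriRoughP2Law : Prop :=
  let W : ℕ → ℝ := fun m => ∑ q ∈ m.primeFactors, if (m / q).Prime ∧ q < m / q ∧ m < q ^ 4 then 2 * Real.log q * Real.log ((m / q : ℕ) : ℝ) else 0; let IsBomb : (ℕ → ℝ) → (ℝ → ℝ) → ArithmeticFunction ℝ → ℝ → Prop := fun a X g H => let R : ℕ → ℝ → ℝ := fun d x => (∑ n ∈ (Finset.Ioc 0 ⌊x⌋₊).filter (d ∣ ·), a n) - g d * X x; g.IsMultiplicative ∧ (∀ n : ℕ, 0 ≤ a n) ∧ ((∀ x : ℝ, X x = ∑ n ∈ (Finset.Ioc 0 ⌊x⌋₊).filter (1 ∣ ·), a n) ∧ ((∀ ε : ℝ, 0 < ε → ∃ C : ℝ, ∀ d : ℕ, 1 ≤ d → |g d| ≤ C * (d : ℝ) ^ (-1 + ε)) ∧ ∀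 d : ℕ, 1 < d → g d < 1) ∧ (∀ ε : ℝ, 0 < ε → ∀ B : ℝ, 0 < B → ∃ C : ℝ, ∀ᶠ x : ℝ in Filter.atTop, ∀ y : ℕ → ℝ, (∀ d, y d ≤ x) → ∑ d ∈ Finset.Ico 1 ⌈x ^ (1 - ε)⌉₊, |R d (y d)| ≤ C * X x / Real.log x ^ B) ∧ (∃ (F : ℕ → ℝ) (c₁ c₂ : ℝ), 0 < c₁ ∧ 0 < c₂ ∧ (∀ ε : ℝ, 0 < ε → ∃ C : ℝ, ∀ d : ℕ, 1 ≤ d → |F d| ≤ C * (d : ℝ) ^ ε) ∧ ((fun x : ℝ => ∑ d ∈ Finset.Ico 1 ⌈x⌉₊, F d ^ 2 / d) =O[Filter.atTop] fun x : ℝ => Real.log x ^ c₂) ∧ ∃ C : ℝ, ∀ᶠ x : ℝ in Filter.atTop, ∀ d : ℕ, 1 ≤ d → (d : ℝ) < x → |R d x| ≤ C * (F d / d) * X x * Real.log x ^ c₁) ∧ (((fun x : ℝ => ∫ t in (1 : ℝ)..x, X t / t) =o[Filter.atTop] fun x : ℝ => X x * Real.log x) ∧ (fun x : ℝ => X (Real.sqrt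 x)) =o[Filter.atTop] fun x : ℝ => X x / Real.log x) ∧ (∃ η₁ : ℝ, 0 < η₁ ∧ ∃ b : ℕ → ℂ, (∀ s : ℂ, -η₁ < s.re → LSeriesSummable b s) ∧ LSeries b 0 ≠ 0 ∧ ∀ s : ℂ, 0 < s.re → LSeries (fun d => ((g d : ℝ) : ℂ)) s = riemannZeta (s + 1) * LSeries b s)) ∧ Filter.Tendsto (fun x : ℕ => ∏ p ∈ Nat.primesLE x, (1 - g p) / (1 - (p : ℝ)⁻¹)) Filter.atTop (nhds H); ∀ (a : ℕ → ℝ) (X : ℝ → ℝ) (g : ArithmeticFunction ℝ) (H : ℝ), IsBomb a X g H → (fun x : ℝ => (∑ n ∈ Finset.Ioc 0 ⌊x⌋₊, W n * a n) - (H * X x * Real.log x - (1 / 2 : ℝ) * ∑ p ∈ Nat.primesLE ⌊x⌋₊, Real.log p ^ 2 * a p)) =o[Filter.atTop] fun x : ℝ => X x * Real.log x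

-- earlier ShiftedPrimesBombieri (stmt-Parity-9386, replaced 2026-08-15T17:01:27Z -> stmt-Parity-11312): retired by None — Literature.NumberTheory.Sieve.LevelOfDistribution.ElliottHalberstam → ∀ h : ℕ, 1 ≤ h → Even h → ∃ A : Literature.NumberTheory.Sieve.SieveSequence, A.a = (fun m : ℕ => if h < m ∧ (m - h).Prime then Real.log ((m - h : ℕ) : ℝ) ^ 2 else 0) ∧ A.density = Literature.NumberTheory.Sieve.
/-- item stmt-Parity-11312 · support · rank 9 · open · by planner
sources: BombieriRIMS1977, HalberstamRichert1974, ElliottHalberstam1970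
[support] EH (EH is spelled out verbatim (`Iff.rfl` with
Literature.NumberTheory.Sieve.LevelOfDistribution.ElliottHalberstam = item EH)) → for every even h
the sequence c_m = log²(m−h)·1_{m−h prime} (m > h), with density g(d) = 1_{(d,h)=1}/φ(d) (pointwise
= shiftedPrimesDensity h), carries a Bombieri structure (X, g), (A₁)–(A₅), with constant 𝔖({0,h}) =
singularSeries {0,h} (INLINED VERBATIM over Mathlib (cone repair 2026-08-15): a 'Bombieri structure
on f with constant H' is data (X, g) — X : ℝ → ℝ the counting function, g a multiplicative
ArithmeticFunction density — with f ≥ 0, X(x) = Σ_{m≤x} f(m), Bombieri's (A₁)–(A₅) and the ordered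
Euler product for H, i.e. by `Iff.rfl` the conjunction g.IsMultiplicative ∧ f ≥ 0 ∧
A.IsBombieriSequence ∧ A.HasDensityConstant H for A = ⟨f, _, X, g, _⟩ :
Literature.NumberTheory.Sieve.SieveSequence (certificate Equiv.lean, attached)). The negative-shift,
log²-weighted, general-even-h analogue of the tree's
hasLevelOfDistribution_shiftedPrimes_of_primesHaveLevel_holds and
bombieri_asymptotic_sieve_shiftedPrimes_holds (h = 2, positive shift): (A₂) from PrimesHaveLevel
(max over y ≤ x and over residues) by partial summation; (A₅) = Euler-product alg -/
@[route_item "route-Parity-RoughSemiprimeRigidity"]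
def ShiftedPrimesBombieri : Prop :=
  let IsBomb : (ℕ → ℝ) → (ℝ → ℝ) → ArithmeticFunction ℝ → ℝ → Prop := fun a X g H => let R : ℕ → ℝ → ℝ := fun d x => (∑ n ∈ (Finset.Ioc 0 ⌊x⌋₊).filter (d ∣ ·), a n) - g d * X x; g.IsMultiplicative ∧ (∀ n : ℕ, 0 ≤ a n) ∧ ((∀ x : ℝ, X x = ∑ n ∈ (Finset.Ioc 0 ⌊x⌋₊).filter (1 ∣ ·), a n) ∧ ((∀ ε : ℝ, 0 < ε → ∃ C : ℝ, ∀ d : ℕ, 1 ≤ d → |g d| ≤ C * (d : ℝ) ^ (-1 + ε)) ∧ ∀ d : ℕ, 1 < d → g d < 1) ∧ (∀ ε : ℝ, 0 < ε → ∀ B : ℝ, 0 < B → ∃ C : ℝ, ∀ᶠ x : ℝ in Filter.atTop, ∀ y : ℕ → ℝ, (∀ d, y d ≤ x) → ∑ d ∈ Finset.Ico 1 ⌈x ^ (1 - ε)⌉₊, |R d (y d)| ≤ C * X x / Real.log x ^ B) ∧ (∃ (F : ℕ → ℝ) (c₁ c₂ : ℝ), 0 < c₁ ∧ 0 < c₂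 ∧ (∀ ε : ℝ, 0 < ε → ∃ C : ℝ, ∀ d : ℕ, 1 ≤ d → |F d| ≤ C * (d : ℝ) ^ ε) ∧ ((fun x : ℝ => ∑ d ∈ Finset.Ico 1 ⌈x⌉₊, F d ^ 2 / d) =O[Filter.atTop] fun x : ℝ => Real.log x ^ c₂) ∧ ∃ C : ℝ, ∀ᶠ x : ℝ in Filter.atTop, ∀ d : ℕ, 1 ≤ d → (d : ℝ) < x → |R d x| ≤ C * (F d / d) * X x * Real.log x ^ c₁) ∧ (((fun x : ℝ => ∫ t in (1 : ℝ)..x, X t / t) =o[Filter.atTop] fun x : ℝ => X x * Real.log x) ∧ (fun x : ℝ => X (Real.sqrt x)) =o[Filter.atTop] fun x : ℝ => X x / Real.log x) ∧ (∃ η₁ : ℝ, 0 < η₁ ∧ ∃ b : ℕ → ℂ, (∀ s : ℂ, -η₁ < s.re → LSeriesSummable b s) ∧ LSeries b 0 ≠ 0 ∧ ∀ s : ℂ, 0 < s.re → LSeries (fun d => ((g d : ℝ) : ℂ)) s = riemannZeta (s + 1) * LSeries b s)) ∧ Filter.Tendsto (fun x : ℕ => ∏ p ∈ Nat.primesLE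 x, (1 - g p) / (1 - (p : ℝ)⁻¹)) Filter.atTop (nhds H); (∀ θ : ℝ, θ < 1 → ∀ A : ℝ, 0 < A → ∀ ε : ℝ, 0 < ε → (fun x : ℝ => ∑ q ∈ Finset.Icc 1 ⌊x ^ (θ - ε)⌋₊, ⨆ y : ↥(Set.Icc (1 : ℝ) x), ⨆ a : (ZMod q)ˣ, |(∑ n ∈ Finset.range (⌊(y : ℝ)⌋₊ + 1), ArithmeticFunction.vonMangoldt.residueClass (a : ZMod q) n) - (y : ℝ) / (Nat.totient q : ℝ)|) =O[Filter.atTop] fun x : ℝ => x / Real.log x ^ A) → ∀ h : ℕ, 1 ≤ h → Even h → ∃ (X : ℝ → ℝ) (g : ArithmeticFunction ℝ), (∀ d : ℕ, g d = if d.Coprime h ∧ d ≠ 0 then ((Nat.totient d : ℝ))⁻¹ else 0) ∧ IsBomb (fun m : ℕ => if h < m ∧ (m - h).Prime then Real.log ((m - h : ℕ) : ℝ) ^ 2 else 0) X g (Literature.NumberTheory.Sieve.singularSeries ({0, (h : ℤ)} : Finset ℤ))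

-- earlier Assembly (stmt-Parity-11315, replaced 2026-08-16T03:06:00Z -> stmt-Parity-14175): retired by None — TwoSidedRigidity → (∀ θ : ℝ, θ < 1 → ∀ A : ℝ, 0 < A → ∀ ε : ℝ, 0 < ε → (fun x : ℝ => ∑ q ∈ Finset.Icc 1 ⌊x ^ (θ - ε)⌋₊, ⨆ y : ↥(Set.Icc (1 : ℝ) x), ⨆ a : (ZMod q)ˣ, |(∑ n ∈ Finset.range (⌊(y : ℝ)⌋₊ + 1), ArithmeticFunction.vonMangoldt.residueClass (a : ZMod q) n) - (y : ℝ) / (Nat.totient q :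
-- earlier Assembly (stmt-Parity-14175, replaced 2026-08-16T04:02:17Z -> stmt-Parity-14601): retired by None — TwoSidedRigidity → (∀ θ : ℝ, θ < 1 → ∀ A : ℝ, 0 < A → ∀ ε : ℝ, 0 < ε → (fun x : ℝ => ∑ q ∈ Finset.Icc 1 ⌊x ^ (θ - ε)⌋₊, ⨆ y : ↥(Set.Icc (1 : ℝ) x), ⨆ a : (ZMod q)ˣ, |(∑ n ∈ Finset.range (⌊(y : ℝ)⌋₊ + 1), ArithmeticFunction.vonMangoldt.residueClass (a : ZMod q) n) - (y : ℝ) / (Nat.totient q :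
-- earlier Assembly (stmt-Parity-14601, replaced 2026-08-16T06:42:13Z -> stmt-Parity-14887): retired by None — TwoSidedRigidity → EH → GEH → GEHGivesRoughBombieri → RoughSemiprimeTwins → PairsAssembly → PairsToGHL → GeneralizedHardyLittlewood
-- earlier Assembly (stmt-Parity-9390, replaced 2026-08-15T17:01:27Z -> stmt-Parity-11315): retired by None — TwoSidedRigidity → Literature.NumberTheory.Sieve.LevelOfDistribution.ElliottHalberstam → RoughSemiprimeBombieri → RoughSemiprimeTwins → PairsAssembly → PairsToGHL → GeneralizedHardyLittlewood
/-- item stmt-Parity-14887 · assembly · rank 1 · open · by planner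
sources: BombieriAsymptoticSieve1976, HardyLittlewood1923, GreenTao2010
[assembly] TwoSidedRigidity → EH → RoughSemiprimeBombieri → RoughSemiprimeTwins → WeightedPairsToGHL
→ GeneralizedHardyLittlewood — literally the type of the crux-only deciding theorem `closes` (g3
repair 2026-08-16), every hypothesis a kind=crux item of this route by its decl name; kept only
because the gate does not allow dropping an assembly item (Assembly is optional since D-0027 §2.1
and proves nothing by itself — `closes` is the proof). [difficulty: provable-now — it IS `closes`] -/
@[route_item "route-Parity-RoughSemiprimeRigidity"]
def Assembly : Prop :=
  TwoSidedRigidity → EH → RoughSemiprimeBombieri → RoughSemiprimeTwins → WeightedPairsToGHL → GeneralizedHardyLittlewood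

-- records of items no longer active in this route (dropped / restated):
-- earlier RankUniformLambdaK (stmt-Parity-9382, replaced 2026-08-15T17:01:27Z -> stmt-Parity-11308): retired by None — ∀ (A : Literature.NumberTheory.Sieve.SieveSequence) (H : ℝ), A.IsBombieriSequence → A.HasDensityConstant H → ∀ ε : ℝ, 0 < ε → ∀ᶠ x : ℝ in Filter.atTop, ∀ k : ℕ, 2 ≤ k → (k : ℝ) ≤ 2 * Real.log (Real.log x) → |(∑ n ∈ Finset.Ioc 0 ⌊x⌋₊, Literature.NumberTheory.Sieve.generalizedVonMango
-- earlier PairsAssembly (stmt-Parity-9388, replaced 2026-08-15T17:01:27Z -> stmt-Parity-11313): retired by None — TwoSidedRigidity → Literature.NumberTheory.Sieve.LevelOfDistribution.ElliottHalberstam → RoughSemiprimeBombieri → RoughSemiprimeTwins → PairsHL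

/-! D-0027 §2.1 — DECIDING THEOREM (planner-authored via `route open/edit --closes-file`; by planner-rbadge-Parity-RoughSemiprimeRigidity-0c478593-g3-0 2026-08-16T06:42:13Z):
its hypotheses are this route's items and its conclusion the sub-problem Statement (glue_lint), and it elaborates with this file. -/

/-- Route glue (D-0027 §2.1), CRUX-ONLY (g3 repair 2026-08-16): every hypothesis is a kind=crux item of this route —
the mechanism `TwoSidedRigidity`, the Elliott–Halberstam input `EH`, the GEH-type input `RoughSemiprimeBombieri`
(Bombieri data for `W(·+h)`; implied by the by-name crux `GEH` through the provable support `GEHGivesRoughBombieri`),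
the interior point `RoughSemiprimeTwins`, and the GHL-hard residual `WeightedPairsToGHL`. Proof: for even `h` take the
Bombieri data `(X, g)` from `RoughSemiprimeBombieri`, subtract the two little-o statements and multiply by 4 to get
log-weighted Hardy–Littlewood pairs `U_h(N) − 𝔖({0,h})·N·log²N = o(N log²N)`, then apply `WeightedPairsToGHL`.
No support, assembly or derivation is a hypothesis. -/
@[closes "route-Parity-RoughSemiprimeRigidity"] theorem closes : TwoSidedRigidity → EH → RoughSemiprimeBombieri → RoughSemiprimeTwins → WeightedPairsToGHL → GeneralizedHardyLittlewood := by
  intro hR hEH hB hT hG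
  apply hG
  intro h hh he
  obtain ⟨X, g, hX⟩ := hB h hh he
  have h1 := hR hEH h hh he X g hX
  have h2 := hT h hh he
  have h3 := (h2.sub h1).const_mul_left 4
  refine h3.congr_left ?_
  intro N
  dsimp only
  ring

end Summit.Parity.GeneralizedHardyLittlewood.Theses.RoughSemiprimeRigidity
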